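import Literature.Topology.FourManifolds.CouplePassage

/-!
# The glued structure map `psi0` of a couple: cone map, exit transports, model conjugations

Topic `Literature/Topology/FourManifolds` (eighth file of the *structure conjugacy* of two
one-level Morse data on a handlebody, support of `stmt-SmoothPoincare4-15190`; the two-function
analogue of `PairPsi.lean`).  Everything here is **proved**; the new definitions are the glued
map and its admissibility predicate.

For a couple `C` with saddle data `Q`, a level map `M`, a direction map `T` and widths `δ, ρ`:

* `SaddleData.psi0 Q M T δ ρ : W → W` — `p₀ ↦ p₀'`; on the rest of the basin of `A` the cone map
  `coneMap A B T lam` (`BasinConeMap.lean`); on the exit domains of width `2δ` the exit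
  transports (`CoupleSaddleRegions.lean`); on the `ρ`-balls of the boxes the model conjugations
  `MC s`; the identity elsewhere;
* `SaddleData.Adm Q M T δ ρ` — **admissibility**: `0 < δ`, `2δ ≤ ε²`, `0 < ρ ≤ ε`,
  `ρ⁴ / 4ε² < 4δ`, rigidity of `T` at every saddle with width `4δ` (`TRigid`,
  `CouplePassage.lean`), and the regularity of `T` on the small sphere of `A`: norm `rad`,
  smoothness, and the `B`-rays of the image directions of basin points meet the image levels.

Under admissibility the pieces agree on overlaps (`CouplePassage.lean`) and cover
`{g_A p₀ < g_A < hi}` (`PairSaddleCover.cover` for `QA`), so `psi0` **is each piece on that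
piece's open domain** (`psi0_eq_coneMap`, `psi0_eq_LT_refExit`, `psi0_eq_MC`), hence is **smooth
with `g_B ∘ psi0 = lam ∘ g_A` on `{g_A p₀ < g_A < hi}`** (`contMDiffAt_psi0`, `apply_psi0`); it
satisfies the **cone law** in the charts at the minima (`psi0_ofChart_smul`), and **the glued map
of the swapped data, the inverse level map and a left inverse `T'` of `T` inverts it**
(`psi0_swap_psi0`).

## References

* J. Milnor, *Lectures on the h-cobordism theorem* (1965), Def. 3.9, Thm. 4.1, proofs of
  Thms. 3.12–3.13 (PDF pp. 16–22). [MilnorHCobordism1965]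
-/

open scoped Manifold ContDiff Topology
open Set Function Filter Metric

noncomputable section

namespace Literature.Topology.FourManifolds

open Cobordism FourManifolds.Flow

universe u

variable {n : ℕ} {W : Type u} [TopologicalSpace W] [T2Space W] [SecondCountableTopology W]
  [CompactSpace W] [ChartedSpace (EuclideanHalfSpace (n + 1)) W] [IsManifold (𝓡∂ (n + 1)) ∞ W]

namespace BasinCouple

variable {gA gB : W → ℝ} {ξA ξB : Π x : W, TangentSpace (𝓡∂ (n + 1)) x} {C : BasinCouple gA gB ξA ξB}

namespace SaddleData

variable (Q : C.SaddleData) (M : Q.LevelMap)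

/-! ### The glued map and admissibility -/

open Classical in
/-- **The glued structure map**: `p₀ ↦ p₀'`, the cone map on the rest of the basin of `A`, the
exit transports (width `2δ`), the model conjugations on the `ρ`-balls, the identity elsewhere. [cite: MilnorHCobordism1965, Thm. 4.1, proof of Thm. 3.13] -/
def psi0 (T : EuclideanSpace ℝ (Fin (n + 1)) → EuclideanSpace ℝ (Fin (n + 1))) (δ ρ : ℝ) (x : W) : W :=
  if x = C.A.p₀ then C.B.p₀
  else if x ∈ C.A.basin then C.A.coneMap C.B T M.lam x
  else if h : ∃ s, x ∈ (Q.refExit M s (2 * δ)).dom then (Q.refExit M h.choose (2 * δ)).LT x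
  else if h : ∃ s : SaddlePt n gA, x ∈ (Q.QA.DA s).chartBall ρ then Q.MC h.choose x
  else x

/-- **Admissibility** of `(T, δ, ρ)`: widths, rigidity of `T` at every saddle, and regularity of
`T` on the small sphere of `A`. [cite: MilnorHCobordism1965, Thm. 4.1, proof of Thm. 3.13] -/
structure Adm (T : EuclideanSpace ℝ (Fin (n + 1)) → EuclideanSpace ℝ (Fin (n + 1))) (δ ρ : ℝ) : Prop where
  /-- the width is positive -/
  δ_pos : 0 < δ
  /-- the exit width `2δ` is at most `ε²` -/
  δ_le : 2 * δ ≤ Q.QA.ε ^ 2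
  /-- the ball radius is positive -/
  ρ_pos : 0 < ρ
  /-- the ball radius is at most `ε` -/
  ρ_le : ρ ≤ Q.QA.ε
  /-- the ball is small compared with the rigidity width -/
  ρ_pow : ρ ^ 4 / (4 * Q.QA.ε ^ 2) < 4 * δ
  /-- `T` is rigid at every saddle with width `4δ` -/
  rigid : ∀ s, Q.TRigid T s (4 * δ)
  /-- `T` preserves the small sphere -/
  norm_T : ∀ v, ‖v‖ = C.A.rad → ‖T v‖ = C.A.rad
  /-- `T` is smooth at the small sphere -/
  contDiffAt_T : ∀ v, ‖v‖ = C.A.rad → ContDiffAt ℝ ∞ T v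
  /-- the `B`-rays of the image directions of basin points meet the image levels -/
  hits_T : ∀ x ∈ C.A.basin, x ≠ C.A.p₀ → gA x < C.A.hi →
    Hits C.B.θ gB (M.lam (gA x)) (C.B.ofChart (T (C.A.dir x)))

variable {Q M}
variable {T T' : EuclideanSpace ℝ (Fin (n + 1)) → EuclideanSpace ℝ (Fin (n + 1))} {δ ρ : ℝ}

/-! ### `psi0` is each piece on that piece's domain -/

/-- **`psi0 p₀ = p₀'`.** [folklore] -/
theorem psi0_p₀ : Q.psi0 M T δ ρ C.A.p₀ = C.B.p₀ := by rw [psi0, if_pos rfl]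

/-- **On the basin (off the minimum), `psi0` is the cone map.** [folklore] -/
theorem psi0_eq_coneMap {x : W} (hx : x ∈ C.A.basin) (hx0 : x ≠ C.A.p₀) :
    Q.psi0 M T δ ρ x = C.A.coneMap C.B T M.lam x := by
  rw [psi0, if_neg hx0, if_pos hx]

/-- A point of an exit domain is not the minimum. [folklore] -/
theorem ne_p₀_of_mem_dom_refExit {s : SaddlePt n gA} {δ' : ℝ} {x : W} (hx : x ∈ (Q.refExit M s δ').dom) :
    x ≠ C.A.p₀ := fun h => hx.2.1 (h ▸ C.A.isMCriticalPt_p₀)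

/-- **On the exit domain of `s` (width `2δ`), `psi0` is the exit transport.** [cite: MilnorHCobordism1965, proof of Thm. 3.13] -/
theorem psi0_eq_LT_refExit (hA : Q.Adm M T δ ρ) {s : SaddlePt n gA} {x : W} (hx : x ∈ (Q.refExit M s (2 * δ)).dom) :
    Q.psi0 M T δ ρ x = (Q.refExit M s (2 * δ)).LT x := by
  by_cases h₁ : x ∈ C.A.basin
  · rw [psi0_eq_coneMap h₁ (ne_p₀_of_mem_dom_refExit hx)]
    exact coneMap_eq_LT_refExit M (hA.rigid s) hA.δ_le (by linarith [hA.δ_pos]) hx h₁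
  · have h : ∃ s, x ∈ (Q.refExit M s (2 * δ)).dom := ⟨s, hx⟩
    rw [psi0, if_neg (ne_p₀_of_mem_dom_refExit hx), if_neg h₁, dif_pos h]
    rw [Q.QA.eq_of_mem_dom_refExit_of_mem_dom_refExit h.choose_spec hx]

/-- **On the `ρ`-ball of the box of `s`, `psi0` is the model conjugation `MC s`.** [cite: MilnorHCobordism1965, proof of Thm. 3.13] -/
theorem psi0_eq_MC (hA : Q.Adm M T δ ρ) {s : SaddlePt n gA} {x : W} (hx : x ∈ (Q.QA.DA s).chartBall ρ) :
    Q.psi0 M T δ ρ x = Q.MC s x := by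
  have hx3 : x ∈ (Q.QA.DA s).chartBall (3 * Q.QA.ε) := ⟨hx.1, by linarith [hx.2, hA.ρ_le, Q.QA.ε_pos]⟩
  have hx0 : x ≠ C.A.p₀ := Q.ne_p₀_of_mem_chartBall hx3
  by_cases h₁ : x ∈ C.A.basin
  · rw [psi0_eq_coneMap h₁ hx0]; exact coneMap_eq_MC M (hA.rigid s) hA.ρ_le hA.ρ_pow hx h₁
  · by_cases h₂ : ∃ s', x ∈ (Q.refExit M s' (2 * δ)).dom
    · obtain ⟨s', hs'⟩ := h₂
      have he := Q.QA.eq_of_mem_chartBall_of_mem_dom_refExit hA.ρ_le hx hs'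
      subst he
      rw [psi0_eq_LT_refExit hA hs']; exact LT_refExit_eq_MC M hA.ρ_le hx hs'
    · have h : ∃ s : SaddlePt n gA, x ∈ (Q.QA.DA s).chartBall ρ := ⟨s, hx⟩
      rw [psi0, if_neg hx0, if_neg h₁, dif_neg h₂, dif_pos h]
      rw [Q.QA.eq_of_mem_chartBall_of_mem_chartBall h.choose_spec hx]

/-- A saddle lies in its `ρ`-ball. [folklore] -/
theorem saddle_mem_chartBall (hρ : 0 < ρ) (s : SaddlePt n gA) : s.1 ∈ (Q.QA.DA s).chartBall ρ :=
  (Q.QA.DA s).mem_chartBall_self hρ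

/-- **`psi0` sends every saddle to the corresponding saddle.** [folklore] -/
theorem psi0_saddle (hA : Q.Adm M T δ ρ) (s : SaddlePt n gA) : Q.psi0 M T δ ρ s.1 = (Q.σ s).1 := by
  rw [psi0_eq_MC hA (saddle_mem_chartBall hA.ρ_pos s), Q.MC_self]

/-! ### Levels and smoothness -/

/-- The direction of a basin point off the minimum has norm `rad`, and its image ray data. [folklore] -/
theorem norm_T_dir (hA : Q.Adm M T δ ρ) {x : W} (hx : x ∈ C.A.basin) (hx0 : x ≠ C.A.p₀) (hxhi : gA x < C.A.hi) :
    ‖T (C.A.dir x)‖ = C.B.rad := by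
  rw [C.rad_eq]; exact hA.norm_T _ (C.A.norm_dir (C.A.hits_sphR_of_mem_basin hx hx0 hxhi.le))

/-- **The level law on the basin.** [folklore] -/
theorem apply_psi0_of_mem_basin (hA : Q.Adm M T δ ρ) {x : W} (hx : x ∈ C.A.basin) (hx0 : x ≠ C.A.p₀)
    (hxhi : gA x < C.A.hi) : gB (Q.psi0 M T δ ρ x) = M.lam (gA x) := by
  rw [psi0_eq_coneMap hx hx0]; exact BasinSetting.apply_coneMap (hA.hits_T x hx hx0 hxhi)

/-- **`g_B ∘ psi0 = lam ∘ g_A` on `{g_A p₀ < g_A < hi}`.** [cite: MilnorHCobordism1965, Thm. 4.1] -/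
theorem apply_psi0 (hA : Q.Adm M T δ ρ) {x : W} (hx : gA x ∈ Ioo (gA C.A.p₀) C.A.hi) :
    gB (Q.psi0 M T δ ρ x) = M.lam (gA x) := by
  have hx0 : x ≠ C.A.p₀ := fun h => by rw [h] at hx; exact lt_irrefl _ hx.1
  rcases Q.QA.cover (δ₂ := 2 * δ) (δ₃ := δ) (by linarith [hA.δ_pos]) hA.δ_pos hx with h | ⟨s, h⟩ | ⟨s, h⟩ | ⟨s, h⟩
  · exact apply_psi0_of_mem_basin hA (BasinSetting.mem_basin_of_mem_dom h) hx0 hx.2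
  · rw [psi0_eq_LT_refExit hA h]; exact RefData.apply_LT h
  · exact apply_psi0_of_mem_basin hA (Q.QA.mem_basin_of_mem_dom_refEnt h) hx0 hx.2
  · rw [h, psi0_saddle hA, Q.apply_saddle_A, Q.apply_saddle_B, M.lam_c]

/-- `psi0` maps `{g_A p₀ < g_A < hi}` into `{g_B p₀' < g_B < hi}`. [folklore] -/
theorem apply_psi0_mem_Ioo (hA : Q.Adm M T δ ρ) {x : W} (hx : gA x ∈ Ioo (gA C.A.p₀) C.A.hi) :
    gB (Q.psi0 M T δ ρ x) ∈ Ioo (gB C.B.p₀) C.B.hi := by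
  rw [apply_psi0 hA hx]; exact M.lam_mem_Ioo_p₀_hi hx

/-- **The cone map is smooth at the basin points off the minimum, below `hi`.** [cite: MilnorHCobordism1965, Thm. 4.1] -/
theorem contMDiffAt_coneMap (hA : Q.Adm M T δ ρ) {x : W} (hx : x ∈ C.A.basin) (hx0 : x ≠ C.A.p₀) (hxhi : gA x < C.A.hi) :
    ContMDiffAt (𝓡∂ (n + 1)) (𝓡∂ (n + 1)) ∞ (C.A.coneMap C.B T M.lam) x := by
  have hhit : Hits C.A.θ gA C.A.sphR x := C.A.hits_sphR_of_mem_basin hx hx0 hxhi.le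
  have hnd : ‖C.A.dir x‖ = C.A.rad := C.A.norm_dir hhit
  have hTn : ‖T (C.A.dir x)‖ = C.B.rad := norm_T_dir hA hx hx0 hxhi
  have hxI : gA x ∈ Ioo (gA C.A.p₀) C.A.hi := ⟨C.A.apply_p₀_lt hx0, hxhi⟩
  refine BasinSetting.contMDiffAt_coneMap (C.A.apply_mem_slab hxhi) (C.A.not_isMCriticalPt_of_mem_basin hx hx0 hxhi.le)
    hhit (hA.contDiffAt_T _ hnd) (M.contDiffAt_lam _) ?_ (C.B.norm_lt_r₀_of_eq_rad hTn) (M.lam_mem_Ioo_lo_hi hxI)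
    (hA.hits_T x hx hx0 hxhi)
  rw [← norm_pos_iff, hTn]; exact C.B.rad_pos

/-- **`psi0` is smooth on `{g_A p₀ < g_A < hi}`.** [cite: MilnorHCobordism1965, Thm. 4.1, proof of Thm. 5.4 Assertion 4] -/
theorem contMDiffAt_psi0 (hA : Q.Adm M T δ ρ) {x : W} (hx : gA x ∈ Ioo (gA C.A.p₀) C.A.hi) :
    ContMDiffAt (𝓡∂ (n + 1)) (𝓡∂ (n + 1)) ∞ (Q.psi0 M T δ ρ) x := by
  have hx0 : x ≠ C.A.p₀ := fun h => by rw [h] at hx; exact lt_irrefl _ hx.1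
  -- the basin case, used twice
  have hbasin : x ∈ C.A.basin → ContMDiffAt (𝓡∂ (n + 1)) (𝓡∂ (n + 1)) ∞ (Q.psi0 M T δ ρ) x := fun hb => by
    have hev : Q.psi0 M T δ ρ =ᶠ[𝓝 x] C.A.coneMap C.B T M.lam :=
      Filter.eventuallyEq_of_mem ((C.A.isOpen_basin.inter isOpen_ne).mem_nhds ⟨hb, hx0⟩)
        fun y hy => psi0_eq_coneMap hy.1 hy.2
    exact hev.contMDiffAt_iff.2 (contMDiffAt_coneMap hA hb hx0 hx.2)
  rcases Q.QA.cover (δ₂ := 2 * δ) (δ₃ := δ) (by linarith [hA.δ_pos]) hA.δ_pos hx with h | ⟨s, h⟩ | ⟨s, h⟩ | ⟨s, h⟩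
  · exact hbasin (BasinSetting.mem_basin_of_mem_dom h)
  · have h' : x ∈ (Q.refExit M s (2 * δ)).dom := h
    have hev : Q.psi0 M T δ ρ =ᶠ[𝓝 x] (Q.refExit M s (2 * δ)).LT :=
      Filter.eventuallyEq_of_mem (RefData.dom_mem_nhds h') fun y hy => psi0_eq_LT_refExit hA hy
    exact hev.contMDiffAt_iff.2 (((Q.refExit M s (2 * δ)).contMDiffOn_LT x h').contMDiffAt (RefData.dom_mem_nhds h'))
  · exact hbasin (Q.QA.mem_basin_of_mem_dom_refEnt h)
  · subst h
    have hev : Q.psi0 M T δ ρ =ᶠ[𝓝 s.1] Q.MC s :=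
      Filter.eventuallyEq_of_mem ((Q.QA.DA s).isOpen_chartBall.mem_nhds (saddle_mem_chartBall hA.ρ_pos s))
        fun y hy => psi0_eq_MC hA hy
    exact hev.contMDiffAt_iff.2 (Q.contMDiffAt_MC (Q.QA.DA s).mem_source
      (by rw [(Q.QA.DA s).coord_self, norm_zero]; linarith [Q.QA.ε_pos]))

/-! ### The cone law at the minimum -/

/-- **In the charts at the minima `psi0` is an exact cone**:
`psi0 (ofChart_A w) = ofChart_B ((‖w‖ / rad) • T ((rad / ‖w‖) • w))` for `0 < ‖w‖ < r₀`. [cite: MilnorHCobordism1965, Def. 3.1 (2), proof of Thm. 3.12] -/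
theorem psi0_ofChart (hA : Q.Adm M T δ ρ) {w : EuclideanSpace ℝ (Fin (n + 1))} (hw0 : w ≠ 0) (hw : ‖w‖ < C.A.r₀) :
    Q.psi0 M T δ ρ (C.A.ofChart w) = C.B.ofChart ((‖w‖ / C.A.rad) • T ((C.A.rad / ‖w‖) • w)) := by
  have hb : C.A.ofChart w ∈ C.A.basin := C.A.ofChart_mem_basin hw
  have h0 : C.A.ofChart w ≠ C.A.p₀ := fun h => hw0 (by rw [← C.A.toChart_ofChart hw.le, h, C.A.toChart_p₀])
  have hwn : 0 < ‖w‖ := norm_pos_iff.2 hw0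
  have hT : ‖T ((C.A.rad / ‖w‖) • w)‖ = C.A.rad := hA.norm_T _ (by
    rw [norm_smul, Real.norm_of_nonneg (div_pos C.A.rad_pos hwn).le, div_mul_cancel₀ _ hwn.ne'])
  rw [psi0_eq_coneMap hb h0]
  refine coneMap_ofChart_of_shift hw0 hw hT (M.lam_of_le_sph _ ?_)
  have h1 : ‖w‖ ^ 2 < C.A.r₀ ^ 2 := by nlinarith [norm_nonneg w]
  unfold BasinSetting.sph; linarith

/-- **The cone law**: `psi0 (ofChart_A (s • v)) = ofChart_B (s • toChart_B (psi0 (ofChart_A v)))` for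
`‖v‖ < r₀`, `v ≠ 0`, `0 < s ≤ 1`. [cite: MilnorHCobordism1965, Def. 3.1 (2)] -/
theorem psi0_ofChart_smul (hA : Q.Adm M T δ ρ) {v : EuclideanSpace ℝ (Fin (n + 1))} (hv : ‖v‖ < C.A.r₀) (hv0 : v ≠ 0)
    {s : ℝ} (hs : 0 < s) (hs1 : s ≤ 1) :
    Q.psi0 M T δ ρ (C.A.ofChart (s • v)) = C.B.ofChart (s • C.B.toChart (Q.psi0 M T δ ρ (C.A.ofChart v))) := by
  have hvn : 0 < ‖v‖ := norm_pos_iff.2 hv0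
  have hsv0 : s • v ≠ 0 := smul_ne_zero hs.ne' hv0
  have hsv : ‖s • v‖ < C.A.r₀ := by
    rw [norm_smul, Real.norm_of_nonneg hs.le]; exact (mul_le_of_le_one_left (norm_nonneg v) hs1).trans_lt hv
  have hnsv : ‖s • v‖ = s * ‖v‖ := by rw [norm_smul, Real.norm_of_nonneg hs.le]
  have hT : ‖T ((C.A.rad / ‖v‖) • v)‖ = C.A.rad := hA.norm_T _ (by
    rw [norm_smul, Real.norm_of_nonneg (div_pos C.A.rad_pos hvn).le, div_mul_cancel₀ _ hvn.ne'])
  have hin : ‖(‖v‖ / C.A.rad) • T ((C.A.rad / ‖v‖) • v)‖ ≤ C.B.r₀ := by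
    rw [norm_smul, Real.norm_of_nonneg (div_pos hvn C.A.rad_pos).le, hT, div_mul_cancel₀ _ C.A.rad_pos.ne', C.r₀_eq]
    exact hv.le
  rw [psi0_ofChart hA hsv0 hsv, psi0_ofChart hA hv0 hv, C.B.toChart_ofChart hin, hnsv, smul_smul, smul_smul,
    show C.A.rad / (s * ‖v‖) * s = C.A.rad / ‖v‖ by field_simp,
    show s * ‖v‖ / C.A.rad = s * (‖v‖ / C.A.rad) by ring]

/-! ### The inverse -/

/-- The image of a basin point off the minimum lies in the basin of `B`, off its minimum. [folklore] -/
theorem psi0_mem_basin (hA : Q.Adm M T δ ρ) {x : W} (hx : x ∈ C.A.basin) (hx0 : x ≠ C.A.p₀) (hxhi : gA x < C.A.hi) :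
    Q.psi0 M T δ ρ x ∈ C.B.basin ∧ Q.psi0 M T δ ρ x ≠ C.B.p₀ ∧ gB (Q.psi0 M T δ ρ x) < C.B.hi := by
  have hxI : gA x ∈ Ioo (gA C.A.p₀) C.A.hi := ⟨C.A.apply_p₀_lt hx0, hxhi⟩
  have hℓ := M.lam_mem_Ioo_p₀_hi hxI
  have hlev : gB (Q.psi0 M T δ ρ x) = M.lam (gA x) := apply_psi0_of_mem_basin hA hx hx0 hxhi
  refine ⟨?_, fun h => ?_, by rw [hlev]; exact hℓ.2⟩
  · rw [psi0_eq_coneMap hx hx0]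
    exact BasinSetting.coneMap_mem_basin (norm_T_dir hA hx hx0 hxhi) hℓ.2.le (hA.hits_T x hx hx0 hxhi)
  · rw [h] at hlev; exact lt_irrefl _ (hlev ▸ hℓ.1)

/-- **The glued map of the swapped data, the inverse level map and a left inverse `T'` of `T` on the
small sphere inverts `psi0`** on `{g_A p₀ < g_A < hi}`. [cite: MilnorHCobordism1965, Thm. 4.1] -/
theorem psi0_swap_psi0 (hA : Q.Adm M T δ ρ) (hA' : Q.swap.Adm M.swap T' δ ρ)
    (hT'T : ∀ v, ‖v‖ = C.A.rad → T' (T v) = v) {x : W} (hx : gA x ∈ Ioo (gA C.A.p₀) C.A.hi) :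
    Q.swap.psi0 M.swap T' δ ρ (Q.psi0 M T δ ρ x) = x := by
  have hx0 : x ≠ C.A.p₀ := fun h => by rw [h] at hx; exact lt_irrefl _ hx.1
  have hbasin : x ∈ C.A.basin → Q.swap.psi0 M.swap T' δ ρ (Q.psi0 M T δ ρ x) = x := fun hb => by
    obtain ⟨h1, h2, -⟩ := psi0_mem_basin hA hb hx0 hx.2
    rw [psi0_eq_coneMap (Q := Q.swap) h1 h2, psi0_eq_coneMap hb hx0]
    exact BasinSetting.coneMap_coneMap hb hx0 hx.2 (norm_T_dir hA hb hx0 hx.2) (hA.hits_T x hb hx0 hx.2)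
      (hT'T _ (C.A.norm_dir (C.A.hits_sphR_of_mem_basin hb hx0 hx.2.le))) (M.lam'_lam _)
  rcases Q.QA.cover (δ₂ := 2 * δ) (δ₃ := δ) (by linarith [hA.δ_pos]) hA.δ_pos hx with h | ⟨s, h⟩ | ⟨s, h⟩ | ⟨s, h⟩
  · exact hbasin (BasinSetting.mem_basin_of_mem_dom h)
  · obtain ⟨hmem, hinv⟩ := LT_refExit_swap_LT M h
    rw [psi0_eq_LT_refExit hA h, psi0_eq_LT_refExit hA' hmem, hinv]
  · exact hbasin (Q.QA.mem_basin_of_mem_dom_refEnt h)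
  · rw [h, psi0_saddle hA, psi0_saddle hA']
    exact congrArg Subtype.val (Q.σ.symm_apply_apply s)

end SaddleData

end BasinCouple

end Literature.Topology.FourManifolds
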